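import Summits.CriticalPhenomena.PercolationContinuityZ3.Theorems.PercNearOneGluingAdditiveGluingDefectStabilityGen
import Summits.CriticalPhenomena.PercolationContinuityZ3.Theorems.PercNearOneGluingNoHeavyLowerTailCSHPeel
import HarnessLib

/-!
# Crux `PercNearOneGluing.AdditiveGluing` (stmt-CriticalPhenomena-4576): ADDITIVE STABILITY, all sizes, through the socket and the
# closure over degenerate weights — an η-approximate decoy-free (S5D) margin yields an η-defective additive gluing inequality, constant 1

Effectivity audit (lane `prim-rate`, seat audit-2; HOME/prim-rate-audit-2/AUDIT-2.md §17.4), deliverable (b), SUBSTITUTES §TOL link (A)→(B);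
support file for the CLOSED crux `AdditiveGluing`; no definitions, no sorries, standard axioms; not used by `AdditiveGluing_proof` (`η = 0`).

* `AGloc.Defect.additiveGluing_defect_of_surplusTransfer_defect`: (S5)_η for ALL relay sets ⟹ `μ(o ↔ A) − t − η ≤ μ(o ↔ b)` whenever
  `μ(a ↔ b) ≥ 1 − t` on `A` — the composition of the graded steps of `…DefectStabilityGen.lean`, verbatim as in the tree's
  `AGloc.additiveGluing_of_surplusTransfer` (`…GenOfSurplusTransfer.lean:253–277`) / `additiveGluing_of_agloc_firstRank` (`…OfAGloc.lean:187–199`).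
* The tree's socket (`CSH.hS5_of_s5dMargin_nil` `…CSHDefs.lean:185–198`, `CSH.surplusTransfer_nondegenerate_of_s5dMargin`
  `…S5Assembly.lean:72–99`) and its closure over degenerate weights (`CSH.surplusTransfer_of_nondegenerate` `…SurplusClosure.lean:140–174`)
  VERBATIM with a margin defect threaded through: if at every NON-DEGENERATE weight function the decoy-free margin
  `CSH.s5dMargin p T r [] o v F` is `≥ −η` (`η ≥ 0`; `o ∉ T`, `v ∉ T`, `o ≠ v`; monotone `F ≥ 0`; injective `m`-compatible rank), then
  clearing the positive denominator `μ(v ↮ T)` gives (S5)_η in the conditional normalisation (`μ(v ↮ T)·η ≤ η`), the closure principle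
  `weights_le_of_forall_pos_lt_one` transports the NON-STRICT inequality (S5)_η to every weight function unchanged, and the first bullet
  finishes: `μ_w(o ↔ A) − t − η ≤ μ_w(o ↔ b)` at EVERY `w`, constant 1 in front of `η`, uniformly in `n`, `|A|`, `w`, `F`
  (`CSH.Defect.additiveGluing_defect_of_s5dMargin_defect`).  This conclusion is literally the hypothesis `hAG` of
  `Quant.Defect.additiveGluing_fintype_defect` / `…stepV_additive_defect` (`…NoHeavyQuantAdditiveGluingTransferDefect.lean`) and of
  `Defect.noHeavyLowerTail_linear_of_additiveGluingDefect` (`…NoHeavyLowerTailLinearModulusDefect.lean`).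
[cite: KozmaNitzan2024, Conj. 1 (p. 3)]
-/

noncomputable section

namespace Summit.CriticalPhenomena.PercolationContinuityZ3.Theorems

open MeasureTheory Set
open Literature.Probability.LatticeModels (prodBernoulli prodBernoulli_real_pos_of_nonempty weights_le_of_forall_pos_lt_one
  prodBernoulli_real_continuous)
open Literature.Probability.Percolation Literature.Probability.Percolation.KNPreFKG

namespace AGloc.Defect

/-- **End-to-end additive stability of segment 2 above the socket**: (S5) with additive defect `η` (conditional normalisation) for ALL relay
sets ⟹ `AdditiveGluing` with slack `t + η`: `μ(o ↔ A) − t − η ≤ μ(o ↔ b)` — constant 1 in front of `η`, uniform in `n`, `|A|`, `w`.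
Composition VERBATIM as in the tree's `AGloc.additiveGluing_of_surplusTransfer` (`:253-277`) /
`additiveGluing_of_agloc_firstRank` (`OfAGloc:187-199`). [cite: KozmaNitzan2024, Conj. 1 (p. 3)] -/
theorem additiveGluing_defect_of_surplusTransfer_defect (η : ℝ) (hη : 0 ≤ η)
    (hS5 : ∀ (n : ℕ) (w : Sym2 (Fin n) → unitInterval) (T : Finset (Fin n)) (o v : Fin n) (F : Set (Fin n) → ℝ) (r : Fin n → ℕ),
      v ∉ T → (∀ S S' : Set (Fin n), S ⊆ S' → F S ≤ F S') → (∀ S, 0 ≤ F S) → Set.InjOn r ↑T →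
      (∀ a ∈ T, ∀ a' ∈ T, r a < r a' →
        ∫ ω, F (openCluster ω a) ∂(prodBernoulli w) ≤ ∫ ω, F (openCluster ω a') ∂(prodBernoulli w)) →
      (prodBernoulli w).real ({ω : BondConfig (Fin n) | ∀ a ∈ T, ¬ (openGraph ω).Reachable v a} ∩ openConn o v) *
          (∫ ω in (⋃ a ∈ T, openConn v a), F (openCluster ω v) ∂(prodBernoulli w) -
            ∑ a ∈ T, (prodBernoulli w).real
                (openConn v a ∩ ⋂ a' ∈ T.filter (fun a' => r a' < r a), (openConn v a')ᶜ : Set (BondConfig (Fin n))) *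
              ∫ ω, F (openCluster ω a) ∂(prodBernoulli w)) ≤
        (prodBernoulli w).real {ω : BondConfig (Fin n) | ∀ a ∈ T, ¬ (openGraph ω).Reachable v a} *
          ((∫ ω in (⋃ a ∈ T, openConn o a), F (openCluster ω o) ∂(prodBernoulli w) -
            ∑ a ∈ T, (prodBernoulli w).real
                (openConn o a ∩ ⋂ a' ∈ T.filter (fun a' => r a' < r a), (openConn o a')ᶜ : Set (BondConfig (Fin n))) *
              ∫ ω, F (openCluster ω a) ∂(prodBernoulli w)) + η)) :
    ∀ (n : ℕ) (w : Sym2 (Fin n) → unitInterval) (A : Finset (Fin n)) (o b : Fin n) (t : ℝ), 0 ≤ t →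
      (∀ a ∈ A, 1 - t ≤ (prodBernoulli w).real (openConn a b)) →
      (prodBernoulli w).real (⋃ a ∈ A, openConn o a) - t - η ≤ (prodBernoulli w).real (openConn o b) := by
  intro n w A o b t ht hrel
  refine additiveGluing_card_of_agloc_firstRank_defect A.card η (fun n' w' A' o' b' r' hA' hr' hc' => ?_) n w A o b t le_rfl ht hrel
  refine agloc_firstRank_of_gen_defect A.card η (fun n'' w'' A'' o'' F r'' hA'' hF hF0 hr'' hc'' => ?_) n' w' A' o' b' r' hA' hr' hc'
  rcases Nat.eq_zero_or_pos A.card with h0 | hpos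
  · -- `A'' = ∅`
    have : A''.card = 0 := by omega
    rw [Finset.card_eq_zero.1 this]
    simpa using hη
  · obtain ⟨K, hK⟩ : ∃ K, A.card = K + 1 := ⟨A.card - 1, by omega⟩
    exact gen_firstRank_of_surplusTransfer_defect K η hη (fun n w T o v F r _ => hS5 n w T o v F r) n'' w'' A'' o'' F r''
      (hK ▸ hA'') hF hF0 hr'' hc''

end AGloc.Defect

namespace CSH.Defect

open Summit.CriticalPhenomena.PercolationContinuityZ3.Theorems.AGloc
open scoped Classical

variable {n : ℕ}

section GeneralV
variable {V : Type*}

/-- R1 with defect: clearing the positive denominator `μ(v ↮ T)` turns the margin defect `−η` into `μ(v↮T)·η ≤ η` on the right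
(tree `CSH.hS5_of_s5dMargin_nil`, `CSHDefs:185-198`, with `η` threaded through). [cite: KozmaNitzan2024, Conj. 1 (p. 3)] -/
theorem hS5_of_s5dMargin_nil_defect (w : Sym2 V → unitInterval) (T : Finset V) (r : V → ℕ) (o v : V) (F : Set V → ℝ) (η : ℝ)
    (hpos : 0 < (prodBernoulli w).real {ω : BondConfig V | ∀ a ∈ (↑T : Set V), ¬ (openGraph ω).Reachable v a})
    (h : -η ≤ s5dMargin w T r [] o v F) :
    (prodBernoulli w).real ({ω : BondConfig V | ∀ a ∈ (↑T : Set V), ¬ (openGraph ω).Reachable v a} ∩ openConn o v) *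
        surplus w T r F v ≤
      (prodBernoulli w).real {ω : BondConfig V | ∀ a ∈ (↑T : Set V), ¬ (openGraph ω).Reachable v a} * (surplus w T r F o + η) := by
  rw [s5dMargin_nil] at h
  set M := (prodBernoulli w).real {ω : BondConfig V | ∀ a ∈ (↑T : Set V), ¬ (openGraph ω).Reachable v a} with hM
  set E := (prodBernoulli w).real ({ω : BondConfig V | ∀ a ∈ (↑T : Set V), ¬ (openGraph ω).Reachable v a} ∩ openConn o v)
    with hE
  have h2 : 0 ≤ M * (surplus w T r F o - E / M * surplus w T r F v + η) := mul_nonneg hpos.le (by linarith)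
  have h3 : M * (surplus w T r F o - E / M * surplus w T r F v) = M * surplus w T r F o - E * surplus w T r F v := by
    field_simp
  have h4 : M * (surplus w T r F o - E / M * surplus w T r F v + η) =
      M * (surplus w T r F o - E / M * surplus w T r F v) + M * η := by ring
  have h5 : M * (surplus w T r F o + η) = M * surplus w T r F o + M * η := by ring
  linarith [h2, h3, h4, h5]

end GeneralV

/-- R3 with defect: (S5)_η at a non-degenerate weight function from the margin bound `−η ≤ s5dMargin`, every observer position
(tree `CSH.surplusTransfer_nondegenerate_of_s5dMargin`, `S5Assembly:72-99`, with `η` threaded through). [cite: KozmaNitzan2024, Conj. 1 (p. 3)] -/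
theorem surplusTransfer_nondegenerate_of_s5dMargin_defect (p : Sym2 (Fin n) → unitInterval) (hp : ∀ e, 0 < p e ∧ p e < 1)
    (T : Finset (Fin n)) (o v : Fin n) (F : Set (Fin n) → ℝ) (r : Fin n → ℕ) (η : ℝ) (hη : 0 ≤ η) (hvT : v ∉ T) (hr : Set.InjOn r ↑T)
    (hcompat : ∀ b ∈ T, ∀ b' ∈ T, r b < r b' →
      ∫ ω, F (openCluster ω b) ∂(prodBernoulli p) ≤ ∫ ω, F (openCluster ω b') ∂(prodBernoulli p))
    (hmarg : o ∉ T → o ≠ v → -η ≤ s5dMargin p T r [] o v F) :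
    (prodBernoulli p).real ({ω : BondConfig (Fin n) | ∀ a ∈ T, ¬ (openGraph ω).Reachable v a} ∩ openConn o v) *
        surplus p T r F v ≤
      (prodBernoulli p).real {ω : BondConfig (Fin n) | ∀ a ∈ T, ¬ (openGraph ω).Reachable v a} * (surplus p T r F o + η) := by
  set μ := prodBernoulli p with hμ
  by_cases hov : o = v
  · subst hov
    have hOO : (openConn o o : Set (BondConfig (Fin n))) = univ :=
      eq_univ_of_forall fun ω => SimpleGraph.Reachable.refl _
    rw [hOO, inter_univ]
    exact mul_le_mul_of_nonneg_left (le_add_of_nonneg_right hη) measureReal_nonneg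
  by_cases hoT : o ∈ T
  · have hempty : ({ω : BondConfig (Fin n) | ∀ a ∈ T, ¬ (openGraph ω).Reachable v a} ∩ openConn o v) = ∅ := by
      refine eq_empty_of_forall_notMem fun ω hω => ?_
      exact hω.1 o hoT (SimpleGraph.Reachable.symm hω.2)
    rw [hempty, measureReal_empty, zero_mul]
    exact mul_nonneg measureReal_nonneg (add_nonneg (surplus_nonneg_of_mem p T r F o hoT hr hcompat) hη)
  · have hne : ({ω : BondConfig (Fin n) | ∀ a ∈ (↑T : Set (Fin n)), ¬ (openGraph ω).Reachable v a}).Nonempty := by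
      refine ⟨∅, fun a ha hreach => ?_⟩
      have hbot : openGraph (∅ : BondConfig (Fin n)) = ⊥ := by
        unfold openGraph; exact SimpleGraph.fromEdgeSet_empty
      rw [hbot, SimpleGraph.reachable_bot] at hreach
      exact hvT (hreach ▸ ha)
    have hpos := prodBernoulli_real_pos_of_nonempty hp hne
    exact hS5_of_s5dMargin_nil_defect p T r o v F η hpos (hmarg hoT hov)

/-- R14 with defect: (S5)_η for all weights from (S5)_η for non-degenerate weights — the closure principle applied to the continuous
functions `f p = μ_p(v↮T, o↔v)·S_v(p)` and `g p = μ_p(v↮T)·(S_o(p) + η)` (tree `CSH.surplusTransfer_of_nondegenerate`, `SurplusClosure:140-174`,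
with `η` threaded through). [cite: KozmaNitzan2024, Conj. 1 (p. 3)] -/
theorem surplusTransfer_of_nondegenerate_defect (T : Finset (Fin n)) (o v : Fin n) (F : Set (Fin n) → ℝ) (η : ℝ)
    (h : ∀ p : Sym2 (Fin n) → unitInterval, (∀ e, 0 < p e ∧ p e < 1) → ∀ r : Fin n → ℕ, Set.InjOn r ↑T →
      (∀ a ∈ T, ∀ a' ∈ T, r a < r a' →
        ∫ ω, F (openCluster ω a) ∂(prodBernoulli p) ≤ ∫ ω, F (openCluster ω a') ∂(prodBernoulli p)) →
      (prodBernoulli p).real ({ω : BondConfig (Fin n) | ∀ a ∈ T, ¬ (openGraph ω).Reachable v a} ∩ openConn o v) *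
          surplus p T r F v ≤
        (prodBernoulli p).real {ω : BondConfig (Fin n) | ∀ a ∈ T, ¬ (openGraph ω).Reachable v a} * (surplus p T r F o + η))
    (w : Sym2 (Fin n) → unitInterval) (r : Fin n → ℕ) (hr : Set.InjOn r ↑T)
    (hcompat : ∀ a ∈ T, ∀ a' ∈ T, r a < r a' →
      ∫ ω, F (openCluster ω a) ∂(prodBernoulli w) ≤ ∫ ω, F (openCluster ω a') ∂(prodBernoulli w)) :
    (prodBernoulli w).real ({ω : BondConfig (Fin n) | ∀ a ∈ T, ¬ (openGraph ω).Reachable v a} ∩ openConn o v) *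
        surplus w T r F v ≤
      (prodBernoulli w).real {ω : BondConfig (Fin n) | ∀ a ∈ T, ¬ (openGraph ω).Reachable v a} * (surplus w T r F o + η) := by
  -- the min-forms as functions of the weights
  set S : Fin n → (Sym2 (Fin n) → unitInterval) → ℝ := fun x p =>
    ∫ ω in (⋃ a ∈ T, openConn x a), (F (openCluster ω x) -
      (if h : (T.filter fun b => ω ∈ (openConn x b : Set (BondConfig (Fin n)))).Nonempty then
        (T.filter fun b => ω ∈ (openConn x b : Set (BondConfig (Fin n)))).inf' h
          (fun b => ∫ η, F (openCluster η b) ∂(prodBernoulli p)) else 0)) ∂(prodBernoulli p) with hS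
  set f : (Sym2 (Fin n) → unitInterval) → ℝ := fun p =>
    (prodBernoulli p).real ({ω : BondConfig (Fin n) | ∀ a ∈ T, ¬ (openGraph ω).Reachable v a} ∩ openConn o v) * S v p with hf
  set g : (Sym2 (Fin n) → unitInterval) → ℝ := fun p =>
    (prodBernoulli p).real {ω : BondConfig (Fin n) | ∀ a ∈ T, ¬ (openGraph ω).Reachable v a} * (S o p + η) with hg
  have hfc : Continuous f := (prodBernoulli_real_continuous _).mul (continuous_minForm T F v)
  have hgc : Continuous g := (prodBernoulli_real_continuous _).mul ((continuous_minForm T F o).add continuous_const)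
  have hfg : ∀ p : Sym2 (Fin n) → unitInterval, (∀ e, 0 < p e ∧ p e < 1) → f p ≤ g p := by
    intro p hp
    obtain ⟨r', hr', hc'⟩ := AGloc.exists_rank_compat T (fun a => ∫ ω, F (openCluster ω a) ∂(prodBernoulli p))
    have key := h p hp r' hr' hc'
    rw [surplus_eq_minForm p T r' F v hr' hc', surplus_eq_minForm p T r' F o hr' hc'] at key
    exact key
  have hw := weights_le_of_forall_pos_lt_one hfc hgc hfg w
  simp only [hf, hg, hS] at hw
  rw [surplus_eq_minForm w T r F v hr hcompat, surplus_eq_minForm w T r F o hr hcompat]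
  exact hw

/-- **End-to-end additive stability of segment 2 from audit-1's boundary object** (the decoy-free (S5D) margin): if at every
NON-DEGENERATE weight function the margin `CSH.s5dMargin p T r [] o v F = Sur_o(T) − μ_p(o↔v | v↮T)·Sur_v(T)` is `≥ −η`
(observers `o ∉ T`, `v ∉ T`, `o ≠ v`, monotone `F ≥ 0`, injective `m`-compatible rank), then at EVERY weight function
`μ_w(o ↔ A) − t − η ≤ μ_w(o ↔ b)` whenever `t ≥ max_a μ_w(a ↮ b)`: socket (R3/R4), closure over degenerate weights (R14/R15),
(S5) ⟹ (GEN) ⟹ (AG-loc) ⟹ crux (R18/R24/R22) — each the tree's proof with `η` threaded through; the constant in front of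
`η` is 1, uniformly in `n`, `|A|`, `w`, `F`. [cite: KozmaNitzan2024, Conj. 1 (p. 3)] -/
theorem additiveGluing_defect_of_s5dMargin_defect (η : ℝ) (hη : 0 ≤ η)
    (h : ∀ (n : ℕ) (p : Sym2 (Fin n) → unitInterval), (∀ e, 0 < p e ∧ p e < 1) →
      ∀ (T : Finset (Fin n)) (o v : Fin n) (F : Set (Fin n) → ℝ) (r : Fin n → ℕ),
      o ∉ T → v ∉ T → o ≠ v → (∀ S S' : Set (Fin n), S ⊆ S' → F S ≤ F S') → (∀ S, 0 ≤ F S) → Set.InjOn r ↑T →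
      (∀ a ∈ T, ∀ a' ∈ T, r a < r a' →
        ∫ ω, F (openCluster ω a) ∂(prodBernoulli p) ≤ ∫ ω, F (openCluster ω a') ∂(prodBernoulli p)) →
      -η ≤ s5dMargin p T r [] o v F) :
    ∀ (n : ℕ) (w : Sym2 (Fin n) → unitInterval) (A : Finset (Fin n)) (o b : Fin n) (t : ℝ), 0 ≤ t →
      (∀ a ∈ A, 1 - t ≤ (prodBernoulli w).real (openConn a b)) →
      (prodBernoulli w).real (⋃ a ∈ A, openConn o a) - t - η ≤ (prodBernoulli w).real (openConn o b) := by
  refine AGloc.Defect.additiveGluing_defect_of_surplusTransfer_defect η hη fun n w T o v F r hvT hF hF0 hr hcompat => ?_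
  exact surplusTransfer_of_nondegenerate_defect T o v F η
    (fun p hp r' hr' hc' => surplusTransfer_nondegenerate_of_s5dMargin_defect p hp T o v F r' η hη hvT hr' hc'
      fun hoT hov => h n p hp T o v F r' hoT hvT hov hF hF0 hr' hc') w r hr hcompat

/- Consistency at `η = 0` (an `example`, not a declaration — its content is the tree's `CSH.additiveGluing_of_csh`,
`…NoHeavyLowerTailCSHToS5.lean:39–47`): the margin hypothesis of `additiveGluing_defect_of_s5dMargin_defect` is discharged by memo
Theorem 2 (`CSH.s5dMargin_nonneg_of_csh`, audit-1's boundary theorem) with the same term as there, and the crux `AdditiveGluing`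
itself comes back — the hypothesis shape is exactly what the tree proves at `η = 0`, so the defect chain is not vacuous. -/
example
    (hCSH : ∀ (n : ℕ) (w : Sym2 (Fin n) → unitInterval), (∀ e, 0 < w e ∧ w e < 1) →
      ∀ (o v x : Fin n) (Y : Finset (Fin n)) (D : List (Fin n)),
      o ≠ v → x ∉ Y → o ≠ x → v ≠ x → o ∉ Y → v ∉ Y → D.Nodup → (∀ d ∈ D, d ≠ x ∧ d ∉ Y ∧ d ≠ o ∧ d ≠ v) →
      CSHHolds w x (↑Y : Set (Fin n)) D o v) :
    Summit.CriticalPhenomena.PercolationContinuityZ3.Theses.PercNearOneGluing.AdditiveGluing := by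
  intro n w A o b t ht hab
  have h := additiveGluing_defect_of_s5dMargin_defect 0 le_rfl
    (fun n p hp T o v F r hoT hvT hov hF _ hr hcompat => by
      have h0 := s5dMargin_nonneg_of_csh p hp o v (fun x Y D => hCSH n p hp o v x Y D hov) T r [] F hF hr hcompat hoT hvT
        List.nodup_nil (fun _ hd => absurd hd List.not_mem_nil)
      linarith)
    n w A o b t ht hab
  linarith

end CSH.Defect

end Summit.CriticalPhenomena.PercolationContinuityZ3.Theorems

end
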